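import Summits.Ventures.PercRepro.SixFourResidueThreeGenericGlue
import Summits.Ventures.PercRepro.SixFourResidueThreeGenericTail

/-!
# PercRepro — C-025 at `(6,4)`: Theorem G₃ for EVERY `g`, unconditional (p2, gen 9 — ruling (nm))

The per-pair tail `PerPairTail` (`SixFourResidueThreeGenericGlue.lean`) is discharged by mine-2's §21.19 tail
`perPair3_tail_forall` (`SixFourResidueThreeGenericTail.lean`, p3's file), so Theorem G₃ holds with no hypothesis:
`J_three_nonneg_of_generic_all : Generic M G → 7 ≤ g → 0 ≤ J₃(G)` — the (α) branch of the `t = 3` clause of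
`SixFourResidue` for every solid, no bound on `g` or on the planes.
-/

namespace PercRepro.SixFour

/-- **The per-pair tail holds** (§21.19, `perPair3_tail_forall`). -/
theorem perPairTail_holds : PerPairTail := perPair3_tail_forall

open Finset ThmH

variable {α : Type*} [DecidableEq α] {M : Matroid α} [M.Finite] {G : Finset α}

/-- **Theorem G₃, unconditional**: `0 ≤ J₃(G)` for every generic rank-`4` set `G ⊆ E` of a simple matroid with `≥ 7`
points. -/
theorem J_three_nonneg_of_generic_all (hs : Simple M) (hG : G ⊆ gr M) (hr : M.eRk (G : Set α) = 4)
    (hgen : Generic M G) (hg : 7 ≤ G.card) : 0 ≤ J M G 3 :=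
  J_three_nonneg_of_generic perPairTail_holds hs hG hr hgen hg

end PercRepro.SixFour
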